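import Summits.PneNP.PneNP.Theorems.ConvexRankGatesConvexGateBlindXorDefs
import Summits.PneNP.PneNP.Theorems.ConvexRankGatesConvexGateBlindStubTransport
import Summits.PneNP.PneNP.Theorems.ConvexRankGatesConvexGateBlindStubXorCanonical
import Summits.PneNP.PneNP.Theorems.ConvexRankGatesConvexGateBlindStubEmbedding
import Summits.PneNP.PneNP.Theorems.ConvexRankGatesConvexGateBlindStubCliqueProjectsXor
import Summits.PneNP.PneNP.Theorems.ConvexRankGatesConvexGateBlindStubPerfectCompleteness

/-!
# `ConvexGateBlind` reduces to ε-exact lifting (line `xor-door-perfect-completeness`, crux stmt-PneNP-10680)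

The sorry-free deliverable of the crux line `xor-door-perfect-completeness` (lead prover-line-stmt-PneNP-10680-0):
five of the six registered stubs of the skeleton `Cruxes/ConvexGateBlind/Lines/xor_door_perfect_completeness.lean`
are landed theorems (`stub_cliqueProjectsXor`, `stub_transport`, `stub_xorCanonical`, `stub_embedding`,
`stub_perfectCompleteness`, all in namespace `Summit.PneNP.PneNP.Theorems.XorDoor`), and composing them gives

* `xor3UnsatConvBlind_of_exactLifting : ExactLifting → Xor3UnsatConvBlind` — the line's transfer target `C⁺`
  (no polynomial `{∧₂, ∨₂} ∪ CONV` circuit computes 3XOR-UNSAT on the 3-sparse pool) follows from ε-exact lifting;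
* `convexGateBlind_of_exactLifting : ExactLifting → ConvexGateBlind` (registered sub-goal) — the crux follows
  from ε-exact lifting.

`ExactLifting` (`XorDoor.ExactLifting`: an unbounded exponent `φ` such that every `(PSD_q ⊕ ℝ^r_{≥0})`-factorisation
of a positive shift `viol_F(x[w]) - ε` of the Index-lift of a degree-`d` perfectly fooled unsatisfiable 3-sparse
system has `q + r ≥ t^{φ d}` for `t ≥ T(F)`, uniformly in `ε`) is the one OPEN stub; its LP half is an explicit
instance of Hrubeš's Open Problem 4 (`…ExactLiftingStrictRank.lean`, `…ExactLiftingAnchored.lean`), and it holds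
against block-junta factorisations of any size (`…ExactLiftingBlockJunta.lean`). This file makes the crux
CONDITIONAL on that single named statement; it does not close the item.
-/

set_option linter.dupNamespace false -- `Summit.PneNP.PneNP.…`: summit = sub-problem (D-0017)

namespace Summit.PneNP.PneNP.Theorems.XorDoor

/-- **`C⁺` from ε-exact lifting.** CONV-blindness of 3XOR-UNSAT on the 3-sparse pool follows from
`ExactLifting` (perfect completeness is proved: `stub_perfectCompleteness`; embedding and canonical form
are proved: `stub_embedding`, `stub_xorCanonical`). -/
theorem xor3UnsatConvBlind_of_exactLifting (hLift : ExactLifting) : Xor3UnsatConvBlind :=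
  stub_xorCanonical (stub_embedding hLift stub_perfectCompleteness)

/-- **The crux `ConvexGateBlind` from ε-exact lifting** (registered sub-goal
`convexGateBlind_of_exactLifting` of stmt-PneNP-10680): universality of CLIQUE under polynomial monotone
AND-projections (`stub_cliqueProjectsXor`, `stub_transport`) carries `C⁺` to the crux. -/
theorem convexGateBlind_of_exactLifting :
    ExactLifting → Summit.PneNP.PneNP.Theses.ConvexRankGates.ConvexGateBlind :=
  fun hLift => stub_transport Pool xor3Unsat stub_cliqueProjectsXor (xor3UnsatConvBlind_of_exactLifting hLift)

end Summit.PneNP.PneNP.Theorems.XorDoor
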